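import Summits.QuantumFields.YangMills.Theorems.BalabanUVNodesN15KingModelFullPropagator

/-!
# BalabanUVNodes ∕ N15 — THE KING-MODEL RUNG, CURVED EDITION (PART R-a): THE UV PROFILE OF THE FULL `A = 0` FLUCTUATION
# PROPAGATOR `G^η_K` — King's per-slice (3.63) SUMMED over (2.17): `|G^η_K(x, y)| ≤ C·Σ_{i<K} Λ^i·e^{−δ·r(x,y)·L^i∕L^K}` for ALL
# pairs, UNIFORMLY in the number of levels `K`, the volume and the mass (the level-by-level profile whose closed form is the power
# law `C′·(L^K∕r)^{d−1} = C′|x − y|^{2−(d+1)}`, part R-b)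
# (Track A, DAG node N15 = NE2; FAN-OUT v1.1 §N15 s3 «KING-MODEL RUNG … + the one-line statement of what the curved case adds»)

HONEST FRAMING.  Count-neutral kernel bookkeeping (cell `pub-ymgap`, seat `pub-ymgap-dag-n15-e` g8; `--supports stmt-QuantumFields-20296
--as helper` = K3⁵ `SpineGivenEndpointR13SepCoP`, WORDS-141; lineage K3 19676 → 19908 → 19912 → 20292 → 20296).  TEMPLATE LITERATURE, `A = 0`: C. King's scalar
U(1)-Higgs MODEL on finite tori ([King1986] §2.2 p. 653 (2.13)–(2.17), p. 654 (2.20), Theorem 3.3 pp. 655–656 ((3.7) p. 656), Prop. 3.7 (3.63) p. 663 — the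
printed per-SLICE kernel bound «`|G^η_{(j)}(x, y)|, |∂^η_μG^η_{(j)}(x, y)| ≤ C{(L^jη)^{2−d}, (L^jη)^{1−d}}·exp[−δ₀(L^jη)^{−1}|x − y|]`»,
King's `d` = this file's `d + 1`), NOT Bałaban's covariant objects; the full-propagator profile below is the (2.17)-SUMMED SHAPE of (3.63)
for King's (2.13) at `A = 0` (Theorem 3.3 ∕ [Ba 4]-type kernel singularity), NOT a printed proposition; NE2⁺ is NOT PRINTED and not
proved here; NOT a node discharge; nothing continuum ∕ ℝ⁴ ∕ OS ∕ mass-gap ∕ Clay.  0 `sorry`, 0 `def`, standard axioms.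

THE POINT.  For King's full `A = 0` fluctuation propagator `G(K, M, m²) = constrainedProp (L^K) M (aK a L K) ((L^K)²) m²` (the covariance of
(2.13), level-`K` lattice units, `η⁻¹ = L^K` fine points per unit block) the rung so far had: the `K`-uniform decay OFF the diagonal
(part O-a `fullProp_decay_unif`, unit blocks `≥ D₀` apart), the crude all-pairs bound `C·Σ_{i<K}Λ^i` (part O-c `fullProp_abs_le_levels`,
no distance at all) and the diagonal order `Θ((L^{d−1})^K)` (O-c `fullProp_diag_ge` ∕ `fullProp_diag_unbounded`); [Ba 4] (1.10) read with
a point source costs `(L^K)^{d+1}` (`King1986/PropagatorDecayUniform`, HONEST SCOPE (ii)).  What was missing is the behaviour BETWEEN the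
diagonal and the unit scale — fine distances `1 ≤ r ≤ L^K` — i.e. the ultraviolet singularity profile of the kernel.  THIS FILE proves it,
again WITHOUT a telescoped sum, by the induction of part O-a read in FINE distance:
* §1 geometry: `tdistT_flatten` (the peel's re-indexing preserves the fine torus distance), `circAbs_mul_add_le` and
  **`tdistT_fine_le_blocks`** (`|x − y|_{fine N M} ≤ N·|B(x) − B(y)|_M + (N − 1)`: a kernel decaying in BLOCK distance at rate `κ` decays
  in FINE distance at rate `κ∕N`, up to `e^{κ}` — the converse of K-lit `mul_tdistT_blocks_le`), `one_le_tdistT_of_ne`;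
* §2 ★ **`fullProp_profile_unif`** — `∃ C, δ > 0` (functions of `d, L, a, m₀²`) with, for EVERY `K ≥ 1` (any spelling `N = L^K`), cube
  `M_μ = 2L^e`, mass `0 < m² ≤ m₀²` and ALL fine `x, y`:  `|G(K, M, m²)(x, y)| ≤ C·Σ_{i<K} Λ^i·exp(−δ·r(x, y)·L^i∕L^K)`, `Λ = L^{d+1}∕L²`,
  `r` = the fine torus distance — the level-`(K−i)` slice seen from the top contributes King's (2.20) factor `Λ^i` times a decay on ITS
  OWN scale `L^{K−i}` (fine units).  INDUCTION ON `K`: base = (1.10) with a point source (`constrainedProp_decay_blocks_unif`) read in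
  fine distance; step = O-a `fullProp_peel_abs_le` + part M `ksSlice_decay_unif` read in fine distance + the induction hypothesis on the
  finer cube (`Σ_{i<K+1} = (i = 0) + Λ·Σ_{i<K}(i ↦ i+1)`); NO threshold and NO gain are needed — every pair is covered;
* PART R-b (`…FullPropagatorPowerLaw`) reads §2 through the tree's `King1986.sliceSum_le`: the power law `|G^η_K(x, y)| ≤ C·(L^K∕r)^{d−1}`
  for `x ≠ y` (`d ≥ 2`) and the diagonal order `(L^K)^{d−1}`; part R-c the gradient twin.
DOWNSTREAM SHAPE SERVED (by name, nothing instantiated): the pointwise sub-unit profile «`|∇_yG_k(x,y)| ≤ C|x − y|^{1−d}`, `1 ≤ |x−y| ≤ L^k`»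
is the UNPRINTED wall input (W1) of the T⁴ cell's `T4TwoSpacingDefect.ConsistencySized` (clause (T2), node NE3 = N16); parts R-b∕R-c are its
kernel ∕ gradient lines for KING'S `A = 0` OBJECT; NOTHING is asserted for Bałaban's `G_k(U)`.
WHAT THE CURVED CASE ADDS (one line): the same profile for `G_k(U)` uniformly over the live window `Reg335` ([B9] prints unit-cube-localised
OPERATOR bounds (3.42)–(3.47) and bounded unit-scale kernels (3.49), (3.133), not the sub-unit pointwise profile).
HONEST SCOPE.  (i) `A = 0`, periodic b.c., odd `L ≥ 3`, `0 < m² ≤ m₀²`, cubes `2L^e`; (ii) lattice units of the level-`K` lattice (parts F–Q);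
(iii) `K ≥ 1`; (iv) every `d` (the power-law reading of part R-b needs `d ≥ 2`); (v) the top term of §2 decays on the unit scale at the
inherited rate `δ∕L^K` per fine site = `δ` per unit block — part O-a's block decay is the same statement off the diagonal with its own rate;
(vi) nothing here is Bałaban's `G_k(U)`; not a discharge.
Locators: [King1986] C. King, CMP **102** (1986) 649–677: (2.13)–(2.17) p. 653, (2.20) p. 654, Theorem 3.3 p. 655, (3.7) p. 656, Prop. 3.7 (3.63)
p. 663, (4.42)–(4.44) p. 675; [Ba 4] = [Balaban1983RegularityDecay] Theorem (1.10) p. 573.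
-/

noncomputable section

namespace Summit.QuantumFields.YangMills.BalabanUVNodes.N15KingModelRung.Curved

open Real Finset Matrix
open Literature.MathematicalPhysics.QuantumFieldTheory.Balaban1983to89 (Params)
open Literature.MathematicalPhysics.QuantumFieldTheory.Balaban1983to89.B5Prop11Plancherel (Tor fine)
open Literature.MathematicalPhysics.QuantumFieldTheory.Balaban1983to89.B4TorusKernel.MultiPeriod (circAbs centre circAbs_add_mul
  abs_add_mul_centre circAbs_le_abs circAbs_nonneg)
open Literature.MathematicalPhysics.QuantumFieldTheory.King1986 (aK aK_pos)
open Literature.MathematicalPhysics.QuantumFieldTheory.King1986.Torus (constrainedProp flatten blockOf tdistT site torCongr toSite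
  fine_fine val_flatten val_torCongr tdistT_torCongr blockOf_flatten exists_eq_site val_site_sub abs_offset_sub_le circAbs_le_tdistT
  exists_coord_eq_tdistT tdistT_eq_zero_of_d tdistT_nonneg one_le_period constrainedProp_decay_blocks_unif)

variable {d : ℕ} (L : ℕ) [NeZero L]

/-! ## §1 Geometry: the peel preserves fine distances; fine distance versus block distance -/

section Geometry

variable (N : ℕ) [NeZero N] (M : Fin (d + 1) → ℕ) [∀ μ, NeZero (M μ)]

/-- The flat re-indexing of the nested torus IS the canonical identification `torCongr` along `N·(L·M_μ) = (N·L)·M_μ` (both are the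
identity on integer representatives). [cite: King1986, (2.20) p.654] -/
theorem flatten_eq_torCongr (x : Tor (fine N (fine L M))) :
    flatten N L M x = torCongr (fine_fine N L M) x := by
  funext μ
  apply ZMod.val_injective
  rw [val_flatten, val_torCongr]

/-- **The peel preserves the FINE torus distance**: `|flatten x − flatten y|_{fine (N·L) M} = |x − y|_{fine N (fine L M)}`.
[cite: King1986, (2.20) p.654] -/
theorem tdistT_flatten (x y : Tor (fine N (fine L M))) :
    tdistT (fine (N * L) M) (flatten N L M x) (flatten N L M y) = tdistT (fine N (fine L M)) x y := by
  rw [flatten_eq_torCongr, flatten_eq_torCongr, tdistT_torCongr]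

omit [NeZero N] in
/-- One coordinate, the converse of K-lit `mul_circAbs_le`: `dist(Nβ + δ, NM_μℤ) ≤ N·dist(β, M_μℤ) + |δ|`. [folklore] -/
theorem circAbs_mul_add_le (Mμ : ℕ) (hMμ : 1 ≤ Mμ) (hN1 : 1 ≤ N) (β δ : ℤ) :
    circAbs (N * Mμ) ((N : ℤ) * β + δ) ≤ (N : ℤ) * circAbs Mμ β + |δ| := by
  have hNM : 1 ≤ N * Mμ := Nat.one_le_iff_ne_zero.mpr (Nat.mul_ne_zero (by omega) (by omega))
  set c : ℤ := centre Mμ β with hc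
  have h1 : |β + (Mμ : ℤ) * c| = circAbs Mμ β := abs_add_mul_centre hMμ β
  have h2 : circAbs (N * Mμ) ((N : ℤ) * β + δ) = circAbs (N * Mμ) ((N : ℤ) * β + δ + ((N * Mμ : ℕ) : ℤ) * c) :=
    (circAbs_add_mul (N * Mμ) _ c).symm
  have h3 : (N : ℤ) * β + δ + ((N * Mμ : ℕ) : ℤ) * c = (N : ℤ) * (β + (Mμ : ℤ) * c) + δ := by
    push_cast; ring
  calc circAbs (N * Mμ) ((N : ℤ) * β + δ)
      = circAbs (N * Mμ) ((N : ℤ) * (β + (Mμ : ℤ) * c) + δ) := by rw [h2, h3]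
    _ ≤ |(N : ℤ) * (β + (Mμ : ℤ) * c) + δ| := circAbs_le_abs hNM _
    _ ≤ |(N : ℤ) * (β + (Mμ : ℤ) * c)| + |δ| := abs_add_le _ _
    _ = (N : ℤ) * circAbs Mμ β + |δ| := by
        rw [abs_mul, abs_of_nonneg (by positivity : (0 : ℤ) ≤ N), h1]

/-- **Fine distance versus block distance, site form**: `|site b j − site b′ j′|_{fine N M} ≤ N·|b − b′|_M + (N − 1)`. [folklore] -/
theorem tdistT_site_le_blocks (b b' : Tor M) (j j' : Fin (d + 1) → Fin N) :
    tdistT (fine N M) (site N M b j) (site N M b' j') ≤ (N : ℝ) * tdistT M b b' + ((N : ℝ) - 1) := by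
  have hN1 : 1 ≤ N := Nat.one_le_iff_ne_zero.mpr (NeZero.ne N)
  obtain ⟨μ, hμ⟩ := exists_coord_eq_tdistT (fine N M) (Nat.succ_ne_zero d) (site N M b j) (site N M b' j')
  rw [hμ, val_site_sub N M b b' j j' μ]
  have hβ := circAbs_mul_add_le N (M μ) (one_le_period M μ) hN1 (((b μ).val : ℤ) - ((b' μ).val : ℤ))
    (((j μ : ℕ) : ℤ) - ((j' μ : ℕ) : ℤ))
  have hblk := circAbs_le_tdistT M b b' μ
  have hoff := abs_offset_sub_le N j j' μ
  have hβR : (circAbs (N * M μ) ((N : ℤ) * (((b μ).val : ℤ) - ((b' μ).val : ℤ)) + (((j μ : ℕ) : ℤ) - ((j' μ : ℕ) : ℤ))) : ℝ)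
      ≤ (N : ℝ) * (circAbs (M μ) (((b μ).val : ℤ) - ((b' μ).val : ℤ)) : ℝ)
        + ((|(((j μ : ℕ) : ℤ) - ((j' μ : ℕ) : ℤ))| : ℤ) : ℝ) := by
    exact_mod_cast hβ
  have hoffR : ((|(((j μ : ℕ) : ℤ) - ((j' μ : ℕ) : ℤ))| : ℤ) : ℝ) ≤ (N : ℝ) - 1 := by exact_mod_cast hoff
  have hN0 : (0 : ℝ) ≤ N := Nat.cast_nonneg _
  have : (fine N M μ) = N * M μ := rfl
  rw [this]
  nlinarith

/-- **Fine distance versus block distance**: `|x − y|_{fine N M} ≤ N·|B(x) − B(y)|_M + (N − 1)` — two fine points are at most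
`N`·(the distance of their blocks) plus a block diameter apart; equivalently `|B(x) − B(y)|_M ≥ |x − y|∕N − 1`. [folklore] -/
theorem tdistT_fine_le_blocks (x y : Tor (fine N M)) :
    tdistT (fine N M) x y ≤ (N : ℝ) * tdistT M (blockOf N M x) (blockOf N M y) + ((N : ℝ) - 1) := by
  obtain ⟨j, hj⟩ := exists_eq_site N M x
  obtain ⟨j', hj'⟩ := exists_eq_site N M y
  have h := tdistT_site_le_blocks N M (blockOf N M x) (blockOf N M y) j j'
  rw [← hj, ← hj'] at h
  exact h

omit [NeZero N] in
/-- **Distinct points are at fine distance `≥ 1`** (the torus distance is an integer-valued metric). [folklore] -/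
theorem one_le_tdistT_of_ne (K : Fin (d + 1) → ℕ) [∀ μ, NeZero (K μ)] {x y : Tor K} (hxy : x ≠ y) : 1 ≤ tdistT K x y := by
  have hne : toSite K x ≠ toSite K y := fun h =>
    hxy (Literature.MathematicalPhysics.QuantumFieldTheory.King1986.Torus.toSite_injective K h)
  have h0 : Literature.MathematicalPhysics.QuantumFieldTheory.Balaban1983to89.B4Sect5Torus.tdist K (toSite K x) (toSite K y) ≠ 0 :=
    fun h => hne (Literature.MathematicalPhysics.QuantumFieldTheory.Balaban1983to89.B6BondEliminationTorus.eq_of_tdist_eq_zero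
      (one_le_period K) h)
  unfold tdistT
  unfold Literature.MathematicalPhysics.QuantumFieldTheory.Balaban1983to89.B4Sect5Torus.tdist at h0 ⊢
  have h1 : (Finset.univ.sup (Literature.MathematicalPhysics.QuantumFieldTheory.Balaban1983to89.B4Sect5Torus.ccoord K (toSite K x)
      (toSite K y)) : ℕ) ≠ 0 := fun h => h0 (by rw [h]; simp)
  exact_mod_cast Nat.one_le_iff_ne_zero.mpr h1

end Geometry

/-- **Block decay read in fine distance**: if `r ≤ N_K·D + (N_K − 1)` (§1 `tdistT_fine_le_blocks`), `1 ≤ N_K ≤ s`, `0 ≤ δ ≤ κ`, then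
`e^{−κD} ≤ e^{κ}·e^{−δ·r∕s}` — a kernel decaying at rate `κ` in the distance of blocks of `N_K` fine points decays at rate `δ∕s` in fine
distance for every coarser scale `s ≥ N_K`, up to the constant `e^{κ}`. [folklore] -/
theorem exp_block_decay_le {κ δ r D NK s : ℝ} (hNK : 1 ≤ NK) (hs : NK ≤ s) (hr : 0 ≤ r) (hδ : 0 ≤ δ) (hδκ : δ ≤ κ)
    (hfine : r ≤ NK * D + (NK - 1)) : Real.exp (-(κ * D)) ≤ Real.exp κ * Real.exp (-(δ * (r / s))) := by
  have hκ : 0 ≤ κ := hδ.trans hδκ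
  have hNK0 : 0 < NK := by linarith
  have hs0 : 0 < s := by linarith
  have h1 : r / s ≤ r / NK := div_le_div_of_nonneg_left hr hNK0 hs
  have h2 : δ * (r / s) ≤ κ * (r / NK) := mul_le_mul hδκ h1 (div_nonneg hr hs0.le) hκ
  have h3 : r / NK ≤ D + 1 := by
    rw [div_le_iff₀ hNK0]
    nlinarith
  have h4 : κ * (r / NK) ≤ κ * D + κ := by
    calc κ * (r / NK) ≤ κ * (D + 1) := mul_le_mul_of_nonneg_left h3 hκ
      _ = κ * D + κ := by ring
  rw [← Real.exp_add]
  exact Real.exp_le_exp.mpr (by linarith)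

/-! ## §2 The profile of the full propagator: `|G^η_K(x, y)| ≤ C·Σ_{i<K} Λ^i·e^{−δ·r·L^i∕L^K}`, all pairs -/

/-- **THE UV PROFILE OF KING'S FULL `A = 0` FLUCTUATION PROPAGATOR** (`constrainedProp (L^K) M (aK a L K) ((L^K)²) m² = (L^K)^{d+1}·A₀⁻¹`,
the covariance of (2.13) in level-`K` lattice units): for odd `L ≥ 3`, `a > 0` and a mass cap `m₀² ≥ 0` there are `C, δ > 0` (functions of
`d, L, a, m₀²`) such that for EVERY number of levels `K ≥ 1` (any spelling `N = L^K`), every cube `M_μ = 2L^e`, every mass `0 < m² ≤ m₀²`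
and ALL fine points `x, y` at fine torus distance `r = |x − y|_{fine N M}`:
`|G^η_K(x, y)| ≤ C·Σ_{i<K} Λ^i·exp(−δ·r·L^i∕L^K)`, `Λ = L^{d+1}∕L²` — the `i`-th level below the top contributes King's (2.20) factor `Λ^i`
times an exponential decay on its own length scale `L^{K−i}` (fine units): Prop. 3.7 (3.63) «`C(L^jη)^{2−d}exp[−δ₀(L^jη)^{−1}|x − y|]`»
summed over (2.17), for the FULL propagator, uniformly in `K`.  Induction on `K` (part O-a's peel `fullProp_peel_abs_le` + part M's slice
decay + [Ba 4] (1.10) at the bottom, both read in fine distance through §1); no threshold, no gain.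
[cite: King1986, (2.13)–(2.17) p.653, (2.20) p.654, Theorem 3.3 p.655, (3.7) p.656, Prop. 3.7 (3.63) p.663, (4.42)–(4.44) p.675; Balaban1983RegularityDecay, Theorem (1.10) p.573] -/
theorem fullProp_profile_unif (hLodd : Odd L) (hL : 2 ≤ L) {a : ℝ} (ha : 0 < a) {m0sq : ℝ} (hm0 : 0 ≤ m0sq) :
    ∃ C δ : ℝ, 0 < C ∧ 0 < δ ∧ ∀ (K : ℕ), 1 ≤ K → ∀ (N : ℕ) [NeZero N], N = L ^ K →
      ∀ (e : ℕ) (M : Fin (d + 1) → ℕ) [∀ μ, NeZero (M μ)], (∀ μ, M μ = 2 * L ^ e) →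
      ∀ (msq : ℝ), 0 < msq → msq ≤ m0sq → ∀ x y : Tor (fine N M),
        |constrainedProp N M (aK a L K) (((N : ℕ) : ℝ) ^ 2) msq x y|
          ≤ C * ∑ i ∈ Finset.range K, ((L : ℝ) ^ (d + 1) / (L : ℝ) ^ 2) ^ i
              * Real.exp (-(δ * (tdistT (fine N M) x y * (L : ℝ) ^ i / (N : ℝ)))) := by
  have hL1 : 1 < L := by omega
  have hLr : (1 : ℝ) ≤ L := by exact_mod_cast hL1.le
  have hL0 : (0 : ℝ) < L := by positivity
  -- the base constants ([Ba 4] (1.10), point source) and the slice constants (part M)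
  obtain ⟨δb, cb, hδb, hcb, Hb⟩ := constrainedProp_decay_blocks_unif (d + 1) L (by omega) ⟨hLodd, hL1⟩ ha hm0
  obtain ⟨Cs, κ, hCs, hκ, Hs⟩ := ksSlice_decay_unif (d := d) L hLodd hL ha hm0
  -- the constants of the theorem
  set Λ : ℝ := (L : ℝ) ^ (d + 1) / (L : ℝ) ^ 2 with hΛdef
  have hΛ : 0 < Λ := by positivity
  set δ : ℝ := min δb κ with hδdef
  have hδ : 0 < δ := lt_min hδb hκ
  have hδb' : δ ≤ δb := min_le_left _ _
  have hδκ : δ ≤ κ := min_le_right _ _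
  set C : ℝ := max ((L : ℝ) ^ (d + 1) * cb * Real.exp δb) (Λ * Cs * Real.exp κ) with hCdef
  have hC : 0 < C := lt_max_of_lt_right (by positivity)
  have hCb : (L : ℝ) ^ (d + 1) * cb * Real.exp δb ≤ C := le_max_left _ _
  have hCsC : Λ * Cs * Real.exp κ ≤ C := le_max_right _ _
  refine ⟨C, δ, hC, hδ, ?_⟩
  intro K hK
  induction K, hK using Nat.le_induction with
  | base =>
    -- `K = 1`: (1.10) with a point source, block currency, read in fine distance
    intro N _ hN e M _ hM msq hmsq hcap x y
    subst hN
    set P : Params := ⟨d + 1, L, e, 1, by omega, ⟨hLodd, hL1⟩⟩ with hPdef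
    have hMK : ∀ μ, M μ = P.sitesPerDir P.K := fun μ => by
      rw [hM μ]
      simp [hPdef, Params.sitesPerDir]
    have h := Hb P rfl rfl le_rfl msq hmsq.le hcap M hMK (L ^ 1) rfl x y
    have hcast : (((L ^ 1 : ℕ) : ℝ)) ^ P.d * cb = (L : ℝ) ^ (d + 1) * cb := by
      simp [hPdef]
    rw [hcast] at h
    set D : ℝ := tdistT M (blockOf (L ^ 1) M x) (blockOf (L ^ 1) M y) with hDdef
    set r : ℝ := tdistT (fine (L ^ 1) M) x y with hrdef
    have hN1 : ((L ^ 1 : ℕ) : ℝ) = L := by push_cast; ring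
    have hfine : r ≤ (L : ℝ) * D + ((L : ℝ) - 1) := by
      have h' := tdistT_fine_le_blocks (L ^ 1) M x y
      rwa [hN1] at h'
    have hexp : Real.exp (-(δb * D)) ≤ Real.exp δb * Real.exp (-(δ * (r / L))) :=
      exp_block_decay_le hLr le_rfl (tdistT_nonneg _ x y) hδ.le hδb' hfine
    rw [Finset.sum_range_one, pow_zero, pow_zero, one_mul, mul_one]
    conv_rhs => rw [hN1]
    calc |constrainedProp (L ^ 1) M (aK a L 1) (((L ^ 1 : ℕ) : ℝ) ^ 2) msq x y|
        ≤ (L : ℝ) ^ (d + 1) * cb * Real.exp (-(δb * D)) := h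
      _ ≤ (L : ℝ) ^ (d + 1) * cb * (Real.exp δb * Real.exp (-(δ * (r / L)))) :=
          mul_le_mul_of_nonneg_left hexp (by positivity)
      _ = (L : ℝ) ^ (d + 1) * cb * Real.exp δb * Real.exp (-(δ * (r / L))) := by ring
      _ ≤ C * Real.exp (-(δ * (r / L))) := mul_le_mul_of_nonneg_right hCb (Real.exp_pos _).le
  | succ K hK IH =>
    intro N _ hN e M _ hM msq hmsq hcap x' y'
    subst hN
    -- the unit lattice IS the cube `M_e`
    obtain rfl : M = fun _ => 2 * L ^ e := funext hM
    -- the slice index of the peeled top slice and the nested coordinates of the two points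
    set i : KSliceIdx d := ⟨e, K, hK, 1, le_rfl, 0, Nat.zero_le e, 1, le_rfl⟩ with hidef
    obtain ⟨x, rfl⟩ := (flatten (L ^ K) L (ksM L i)).surjective x'
    obtain ⟨y, rfl⟩ := (flatten (L ^ K) L (ksM L i)).surjective y'
    -- the fine distance (preserved by the peel) and the block distance one level down
    set r : ℝ := tdistT (fine (L ^ K) (ksU L i)) x y with hrdef
    set Dsub : ℝ := tdistT (ksU L i) (blockOf (L ^ K) (ksU L i) x) (blockOf (L ^ K) (ksU L i) y) with hDsubdef
    set NK : ℝ := ((L ^ K : ℕ) : ℝ) with hNKdef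
    have hNK1 : 1 ≤ NK := by
      rw [hNKdef]
      exact_mod_cast Nat.one_le_pow K L (by omega)
    have hNK0 : 0 < NK := by linarith
    have hNKL : NK ≤ NK * L := le_mul_of_one_le_right hNK0.le hLr
    have hcastN : ((L ^ K * L : ℕ) : ℝ) = NK * L := by rw [hNKdef]; push_cast; ring
    have hr0 : 0 ≤ r := tdistT_nonneg _ x y
    have hfine : r ≤ NK * Dsub + (NK - 1) := tdistT_fine_le_blocks (L ^ K) (ksU L i) x y
    -- the mass one level down
    have hL2 : (0 : ℝ) < (L : ℝ) ^ 2 := by positivity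
    have hm2 : 0 < msq / (L : ℝ) ^ 2 := div_pos hmsq hL2
    have hm2cap : msq / (L : ℝ) ^ 2 ≤ m0sq := by
      have h1 : (1 : ℝ) ≤ (L : ℝ) ^ 2 := one_le_pow₀ hLr
      exact (div_le_self hmsq.le h1).trans hcap
    -- the induction hypothesis on the finer cube `fine L M_e = (2L^{e+1})`, ALL pairs
    have hM' : ∀ μ, ksU L i μ = 2 * L ^ (e + 1) := fun μ => by
      show L * (2 * L ^ e) = 2 * L ^ (e + 1)
      ring
    have hIH := IH (L ^ K) rfl (e + 1) (ksU L i) hM' (msq / (L : ℝ) ^ 2) hm2 hm2cap x y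
    -- the slice decay, read in fine distance at the NEW top scale `L^{K+1} = NK·L`
    have hS : |ksSlice L a (msq / (L : ℝ) ^ 2) i x y| ≤ Cs * Real.exp (-(κ * Dsub)) :=
      (Hs (msq / (L : ℝ) ^ 2) hm2 hm2cap i).1 x y
    have hexpS : Real.exp (-(κ * Dsub)) ≤ Real.exp κ * Real.exp (-(δ * (r / (NK * L)))) :=
      exp_block_decay_le hNK1 hNKL hr0 hδ.le hδκ hfine
    have hS' : |ksSlice L a (msq / (L : ℝ) ^ 2) i x y| ≤ Cs * Real.exp κ * Real.exp (-(δ * (r / (NK * L)))) := by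
      calc |ksSlice L a (msq / (L : ℝ) ^ 2) i x y| ≤ Cs * Real.exp (-(κ * Dsub)) := hS
        _ ≤ Cs * (Real.exp κ * Real.exp (-(δ * (r / (NK * L))))) := mul_le_mul_of_nonneg_left hexpS hCs.le
        _ = Cs * Real.exp κ * Real.exp (-(δ * (r / (NK * L)))) := by ring
    -- the peel
    have hpeel := fullProp_peel_abs_le L hL ha hmsq i x y
    -- the level sums: `Σ_{i<K+1} t(i) = t(0) + Λ·Σ_{i<K} t_sub(i)`
    have hshift : ∀ j : ℕ, Λ ^ (j + 1) * Real.exp (-(δ * (r * (L : ℝ) ^ (j + 1) / (NK * L))))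
        = Λ * (Λ ^ j * Real.exp (-(δ * (r * (L : ℝ) ^ j / NK)))) := fun j => by
      have he : r * (L : ℝ) ^ (j + 1) / (NK * L) = r * (L : ℝ) ^ j / NK := by
        rw [pow_succ, ← mul_assoc, mul_div_mul_right _ _ hL0.ne']
      rw [he, pow_succ]
      ring
    have hsum : ∑ j ∈ Finset.range (K + 1), Λ ^ j * Real.exp (-(δ * (r * (L : ℝ) ^ j / (NK * L))))
        = Real.exp (-(δ * (r / (NK * L))))
          + Λ * ∑ j ∈ Finset.range K, Λ ^ j * Real.exp (-(δ * (r * (L : ℝ) ^ j / NK))) := by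
      rw [Finset.sum_range_succ', pow_zero, pow_zero, one_mul, mul_one, Finset.mul_sum, add_comm]
      congr 1
      exact Finset.sum_congr rfl fun j _ => hshift j
    -- the goal in the peel's spelling (`L^{K+1} = L^K·L`, `M_e = ksM L i` definitionally), fine distance through `tdistT_flatten`
    show |constrainedProp (L ^ K * L) (ksM L i) (aK a L (K + 1)) (((L ^ K * L : ℕ) : ℝ) ^ 2) msq
            (flatten (L ^ K) L (ksM L i) x) (flatten (L ^ K) L (ksM L i) y)|
        ≤ C * ∑ j ∈ Finset.range (K + 1), Λ ^ j * Real.exp (-(δ *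
            (tdistT (fine (L ^ K * L) (ksM L i)) (flatten (L ^ K) L (ksM L i) x) (flatten (L ^ K) L (ksM L i) y)
              * (L : ℝ) ^ j / ((L ^ K * L : ℕ) : ℝ))))
    conv_rhs => rw [tdistT_flatten, hcastN, ← hrdef, hsum]
    calc |constrainedProp (L ^ K * L) (ksM L i) (aK a L (K + 1)) (((L ^ K * L : ℕ) : ℝ) ^ 2) msq
            (flatten (L ^ K) L (ksM L i) x) (flatten (L ^ K) L (ksM L i) y)|
        ≤ Λ * (|constrainedProp (L ^ K) (ksU L i) (aK a L K) (((L ^ K : ℕ) : ℝ) ^ 2) (msq / (L : ℝ) ^ 2) x y|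
            + |ksSlice L a (msq / (L : ℝ) ^ 2) i x y|) := hpeel
      _ ≤ Λ * (C * ∑ j ∈ Finset.range K, Λ ^ j * Real.exp (-(δ * (r * (L : ℝ) ^ j / NK)))
            + Cs * Real.exp κ * Real.exp (-(δ * (r / (NK * L))))) :=
          mul_le_mul_of_nonneg_left (add_le_add hIH hS') hΛ.le
      _ = C * (Λ * ∑ j ∈ Finset.range K, Λ ^ j * Real.exp (-(δ * (r * (L : ℝ) ^ j / NK))))
            + Λ * Cs * Real.exp κ * Real.exp (-(δ * (r / (NK * L)))) := by ring
      _ ≤ C * (Λ * ∑ j ∈ Finset.range K, Λ ^ j * Real.exp (-(δ * (r * (L : ℝ) ^ j / NK))))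
            + C * Real.exp (-(δ * (r / (NK * L)))) := by
          have := mul_le_mul_of_nonneg_right hCsC (Real.exp_pos (-(δ * (r / (NK * L))))).le
          linarith
      _ = C * (Real.exp (-(δ * (r / (NK * L))))
            + Λ * ∑ j ∈ Finset.range K, Λ ^ j * Real.exp (-(δ * (r * (L : ℝ) ^ j / NK)))) := by ring

end Summit.QuantumFields.YangMills.BalabanUVNodes.N15KingModelRung.Curved
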